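import Summits.QuantumFields.BalabanUV.Beta.EriceRemainderEnclosureHistoryAutonomyComparisonAgeCompositionTwoOldLevels
import Summits.QuantumFields.BalabanUV.Beta.EriceRemainderEnclosureHistoryAutonomyComparisonAgeCompositionWideOldPairSeparatedAges
import Summits.QuantumFields.BalabanUV.Beta.EriceRemainderEnclosureHistoryAutonomyComparisonAgeCompositionTwoOldLevelsBoxesD
import Summits.QuantumFields.BalabanUV.Beta.EriceRemainderEnclosureHistoryAutonomyComparisonAgeCompositionOldTripleCapC4G
import Summits.QuantumFields.BalabanUV.Beta.EriceRemainderEnclosureHistoryAutonomyComparisonAgeCompositionOldTripleCapCG4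
import Summits.QuantumFields.BalabanUV.Beta.EriceRemainderEnclosureHistoryAutonomyComparisonAgeCompositionOldTripleCapC8G
import Summits.QuantumFields.BalabanUV.Beta.EriceRemainderEnclosureHistoryAutonomyComparisonAgeCompositionOldTripleCapCG8
import Summits.QuantumFields.BalabanUV.Beta.EriceRemainderEnclosureHistoryAutonomyComparisonAgeCompositionFiveAgesTwoLevelsA
import Summits.QuantumFields.BalabanUV.Beta.EriceRemainderEnclosureHistoryAutonomyComparisonAgeCompositionFiveAgesTwoLevelsB
import Summits.QuantumFields.BalabanUV.Beta.EriceRemainderEnclosureHistoryAutonomyComparisonAgeCompositionFiveAgesTwoLevelsC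
import Summits.QuantumFields.BalabanUV.Beta.EriceRemainderEnclosureHistoryAutonomyComparisonAgeCompositionFiveAgesFar

/-!
# EriceRemainderEnclosureHistoryAutonomyComparisonAgeCompositionFiveAgesTwoLevelsD — (E105i) route (N), first order: THE CENSUS FIVE AGES WITH TWO OLD LEVELS, IV (cells (3,4]×(8,16], (8,16]×(3,4], (4,8]×(8,16], (8,16]×(4,8]) AND THE UNIONS AT SEPARATION 184.
# The census five ages `{1,k₂,k₃,k₄,k₅}` on the wide cells with the old triple split into TWO capped levels ((E105e) wrappers, (E105a–d) certificates,
# (E103) triple caps, (E102) pair caps): for EVERY `k₂ ≥ 2` (young pair for `k₂ ≤ 29`, four adaptive levels for `k₂ ≥ 30`) the separation `ρ·k₂ ≤ k₃`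
# drops from the one-block values of (E104) (`86 … 493`) to (4,16) → 63, (16,4) → 59, (8,16) → 90, (16,8) → 78.

Cell `pub-balaban`, β-function sub-cell, BINDER row D4 «RemainderConst leaves for Bałaban's split» (`HOME/BINDER-OWNERS.md`; owner lineage `b2b-balaban-beta-an4`;
this file by co-owner #2 lineage `b2b-balaban-beta-d4-p2`, generation 89), β-FLOW TEAM duty (1), FREEZE (0) honoured (def-free; nothing restated).

HONEST FRAMING (page 1, verbatim and binding).  *"Discharging BetaPertH makes Bałaban's UV stability UNCONDITIONAL — a real constructive-QFT result; it is
NOT the continuum limit and NOT the Clay problem."*  THIS FILE DISCHARGES NOTHING OF THE KIND.  Elementary real algebra ∕ real analysis about ABSTRACT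
functionals on a box ]0,γ]^ℕ with displayed floors, profiles and signs, and the FIRST-ORDER renewal objects of route (N) built from them — hypotheses of a
census, not facts; the form, signs, ages and moments of Bałaban's (1.22) limit functional are NOT PRINTED ([I] p. 298; GAPS G-t4-U2-1∕-2) and NOT asserted.
Row D4 class UNCHANGED (critical-path width 0; instance 0∕1; D4 DISCHARGE NO DATE).  HONEST DEPENDENCY: continuum YM on T⁴ ⇐ BetaPertH ∧ nine spine
estimates (0/9 proved); BetaPertH ⇐ (D1) ∧ (D4) ∧ CAP+tail; G-an2-4 gates asym, D1 and NE2/3/4.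

THE POINT (README `HOME/b2b-balaban-beta-d4-p2/g89/README.md` §4(2)).  Uses the modules opened below BY NAME.  NOT CLAIMED: `(4,8]²` below 184 and `(8,16]²` (three
SEPARATE old levels, a 2-dimensional certificate — successor); anything printed — NOT B12 Thm 2, NOT BetaPertH, NOT continuum, NOT Clay.

WHAT IS PROVED ([folklore]; 0 `def`, 0 sorry).  The per-cell theorems `flow_nonneg_census_five_ages_cXY_two`; **`flow_nonneg_census_five_ages_top8_two ∕ _top8x16_two ∕ _top16x8_two`** (separation 184).
-/
noncomputable section
open Finset

namespace Summit.QuantumFields.BalabanUV.Beta.EriceRemainderEnclosureHistoryAutonomyComparisonAgeCompositionFiveAgesTwoLevelsD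

open Literature.MathematicalPhysics.QuantumFieldTheory.Balaban1983to89
open Literature.MathematicalPhysics.QuantumFieldTheory.Balaban1983to89.T4BetaStationary
open Literature.MathematicalPhysics.QuantumFieldTheory.Balaban1983to89.T4BetaFlowWellPosed
open Summit.QuantumFields.BalabanUV.Beta.EriceRemainderEnclosureHistoryAutonomyComparisonAgeCompositionTwoOldLevels (flow_nonneg_young_pair_two_old_levels_of_cert flow_nonneg_far_two_old_levels_of_cert)
open Summit.QuantumFields.BalabanUV.Beta.EriceRemainderEnclosureHistoryAutonomyComparisonAgeCompositionYoungPairMoment (load_le_of_sq)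
open Summit.QuantumFields.BalabanUV.Beta.EriceRemainderEnclosureHistoryAutonomyComparisonAgeCompositionOldPairCap (near_pair_load_le)
open Summit.QuantumFields.BalabanUV.Beta.EriceRemainderEnclosureHistoryAutonomyComparisonAgeCompositionOldPairCapWide (old_pair_load_le_span3)
open Summit.QuantumFields.BalabanUV.Beta.EriceRemainderEnclosureHistoryAutonomyComparisonAgeCompositionWideOldPairSeparatedAges (wide_pair_load_le4 wide_pair_load_le8 wide_pair_load_le16)
open Summit.QuantumFields.BalabanUV.Beta.EriceRemainderEnclosureHistoryAutonomyComparisonAgeCompositionTwoOldLevelsBoxesD (cert_c4g cert_cg4 cert_c8g cert_cg8)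
open Summit.QuantumFields.BalabanUV.Beta.EriceRemainderEnclosureHistoryAutonomyComparisonAgeCompositionOldTripleCapC4G (old_triple_load_le_c4g)
open Summit.QuantumFields.BalabanUV.Beta.EriceRemainderEnclosureHistoryAutonomyComparisonAgeCompositionOldTripleCapCG4 (old_triple_load_le_cg4)
open Summit.QuantumFields.BalabanUV.Beta.EriceRemainderEnclosureHistoryAutonomyComparisonAgeCompositionOldTripleCapC8G (old_triple_load_le_c8g)
open Summit.QuantumFields.BalabanUV.Beta.EriceRemainderEnclosureHistoryAutonomyComparisonAgeCompositionOldTripleCapCG8 (old_triple_load_le_cg8)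
open Summit.QuantumFields.BalabanUV.Beta.EriceRemainderEnclosureHistoryAutonomyComparisonAgeCompositionFiveAgesTwoLevelsA
open Summit.QuantumFields.BalabanUV.Beta.EriceRemainderEnclosureHistoryAutonomyComparisonAgeCompositionFiveAgesTwoLevelsB
open Summit.QuantumFields.BalabanUV.Beta.EriceRemainderEnclosureHistoryAutonomyComparisonAgeCompositionFiveAgesTwoLevelsC
open Summit.QuantumFields.BalabanUV.Beta.EriceRemainderEnclosureHistoryAutonomyComparisonAgeCompositionFiveAgesFar (flow_nonneg_census_five_ages_top4_every)

variable {B : (ℕ → ℝ) → ℝ} {γ b gIR : ℝ} {L : ℕ → ℝ} {K : ℕ} {h g : ℕ → ℝ}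

/-- **THE CENSUS FIVE AGES ON THE CELL `k₄∕k₃ ∈ (3,4]`, `k₅∕k₄ ∈ (8,16]` WITH TWO OLD LEVELS (option C): EVERY `k₂ ≥ 2`, `63·k₂ ≤ k₃`.**
`0 ≤ ε ≤ e` at every pin, every horizon, every damping of the self-consistent class ((E105e) with the certificate `cert_c4g`; one block needed `ρ₀ =
148` (E104)). [folklore] -/
theorem flow_nonneg_census_five_ages_c4g_two
    (hmono : ∀ u v : ℕ → ℝ, SeqBox γ u → SeqBox γ v → (∀ j, u j ≤ v j) → B u ≤ B v)
    (hL : ∀ k, 0 ≤ L k) (hb : 0 < b) (hlo : ∀ u, SeqBox γ u → b ≤ B u) (hdom : ∀ u, SeqBox γ u → ∑ k ∈ range K, L k * u k ≤ B u)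
    (hh : SeqBox γ h) (hf : MemFlow B gIR h) (hg : ∀ t, 0 < g t ∧ g t ≤ 1)
    (hgF : ∀ t, 1 ≤ g t * (1 + ∑ k ∈ range K, L k * h (t + k) ^ 3 / 2))
    {k₂ k₃ k₄ k₅ : ℕ} (hk2 : 2 ≤ k₂) (hk3 : 63 * k₂ ≤ k₃)
    (h34l : 3 * k₃ < k₄) (h34h : k₄ ≤ 4 * k₃) (h45l : 8 * k₄ < k₅) (h45h : k₅ ≤ 16 * k₄) (hk5K : k₅ < K)
    (hLa : ∀ l, l < K → l ≠ 1 → l ≠ k₂ → l ≠ k₃ → l ≠ k₄ → l ≠ k₅ → L l = 0)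
    {N : ℕ} {KL : ℕ → ℕ → ℕ → ℝ}
    (hKL : ∀ k n l, KL k n l = if 0 < k ∧ k < K ∧ l < k then L k * h (n + k) ^ 3 / 2 * ∏ t ∈ Ico (n + 1 + l) (n + k + 1), g t else 0)
    {KA : ℕ → ℕ → ℕ → ℝ} {RA : ℕ → (ℕ → ℝ) → ℕ → ℝ}
    (hRA : ∀ i v m, RA i v m = ∑ l ∈ range K, KA i m l * v (m + 1 + l))
    (hKA : ∀ i m l, KA i m l = KL i m l + KA (i + 1) m l) (hKAtop : ∀ m l, KA K m l = 0)
    {e ε : ℕ → ℝ} (he0 : ∀ m, 0 ≤ e m) (hea : ∀ m, e (m + 1) ≤ e m)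
    (hεt : ∀ m, N < m → ε m = 0) (hεrec : ∀ m, ε m = e m - RA 1 ε m) : ∀ m, 0 ≤ ε m ∧ ε m ≤ e m := by
  have hk3r : (0 : ℝ) < k₃ := by exact_mod_cast (show 0 < k₃ by omega)
  have hk4r : (0 : ℝ) < k₄ := by exact_mod_cast (show 0 < k₄ by omega)
  have hρ : (63 : ℝ) * k₂ ≤ k₃ := by exact_mod_cast hk3
  have hG : (8 : ℝ) * k₄ ≤ k₅ := by exact_mod_cast h45l.le
  have hr5 : (56 : ℝ) ≤ k₅ := by exact_mod_cast (show 56 ≤ k₅ by omega)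
  have hX1c : ∀ q, ∑ k ∈ ({k₃, k₄} : Finset ℕ), (k : ℝ) * (L k * h (q + k) ^ 3 / 2) ≤ 129 / 200 := fun q =>
    (wide_pair_load_le4 hmono hL hb hlo hdom hh hf (by omega) (by omega) (by omega) (by omega) q)
  have hX2c : ∀ q, ∑ k ∈ ({k₅} : Finset ℕ), (k : ℝ) * (L k * h (q + k) ^ 3 / 2) ≤ 3071 / 5000 := fun q => by
    rw [sum_singleton]; exact load_le_of_sq hmono hL hb hlo hdom hh hf (by omega) hk5K (so := 3071 / 5000) (by norm_num) (by nlinarith) q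
  have hjoint : ∀ q, ∑ k ∈ ({k₃, k₄} : Finset ℕ), (k : ℝ) * (L k * h (q + k) ^ 3 / 2) + ∑ k ∈ ({k₅} : Finset ℕ), (k : ℝ) * (L k * h (q + k) ^ 3 / 2) ≤ 22 / 25 := fun q => by
    rw [sum_singleton, sum_pair (show k₃ ≠ k₄ by omega)]
    exact old_triple_load_le_c4g hmono hL hb hlo hdom hh hf (by omega) h34l h34h h45l h45h hk5K q
  rcases le_or_gt k₂ 29 with h29 | h30
  · exact flow_nonneg_young_pair_two_old_levels_of_cert hmono hL hb hlo hdom hh hf hg hgF hk2 h29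
      (S₁ := {k₃, k₄}) (S₂ := {k₅}) (lo₁ := k₃) (hi₁ := k₄) (lo₂ := k₅) (hi₂ := k₅)
      (fun k hk => by simp only [mem_insert, mem_singleton] at hk; omega) (fun k hk => by rw [mem_singleton] at hk; omega)
      (by omega) (by omega) (by omega) le_rfl hk5K (c₁ := 129 / 200) (c₂ := 3071 / 5000) (V := 22 / 25) (by norm_num) hX1c hX2c hjoint
      (fun X₁ X₂ κ₁ h1 h2 h3 h4 h5 h6 => cert_c4g h1 h2 h3 h4 hk3r hk4r hG hρ h5 h6)
      (fun l hl h1 h2 h3 h4 => hLa l hl h1 h2 (fun he => h3 (by rw [he]; exact mem_insert_self _ _))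
        (fun he => h3 (by rw [he]; exact mem_insert_of_mem (mem_singleton_self _))) (fun he => h4 (by rw [he]; exact mem_singleton_self _)))
      hKL hRA hKA hKAtop he0 hea hεt hεrec
  · exact flow_nonneg_far_two_old_levels_of_cert hmono hL hb hlo hdom hh hf hg hgF (by omega)
      (S₁ := {k₃, k₄}) (S₂ := {k₅}) (lo₁ := k₃) (hi₁ := k₄) (lo₂ := k₅) (hi₂ := k₅)
      (fun k hk => by simp only [mem_insert, mem_singleton] at hk; omega) (fun k hk => by rw [mem_singleton] at hk; omega)
      (by omega) (by omega) (by omega) le_rfl hk5K (c₁ := 129 / 200) (c₂ := 3071 / 5000) (V := 22 / 25) (by norm_num) hX1c hX2c hjoint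
      (fun X₁ X₂ κ₁ h1 h2 h3 h4 h5 h6 => cert_c4g h1 h2 h3 h4 hk3r hk4r hG hρ h5 h6)
      (fun l hl h1 h2 h3 h4 => hLa l hl h1 h2 (fun he => h3 (by rw [he]; exact mem_insert_self _ _))
        (fun he => h3 (by rw [he]; exact mem_insert_of_mem (mem_singleton_self _))) (fun he => h4 (by rw [he]; exact mem_singleton_self _)))
      hKL hRA hKA hKAtop he0 hea hεt hεrec
/-- **THE CENSUS FIVE AGES ON THE CELL `k₄∕k₃ ∈ (8,16]`, `k₅∕k₄ ∈ (3,4]` WITH TWO OLD LEVELS (option B): EVERY `k₂ ≥ 2`, `59·k₂ ≤ k₃`.**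
`0 ≤ ε ≤ e` at every pin, every horizon, every damping of the self-consistent class ((E105e) with the certificate `cert_cg4`; one block needed `ρ₀ =
164` (E104)). [folklore] -/
theorem flow_nonneg_census_five_ages_cg4_two
    (hmono : ∀ u v : ℕ → ℝ, SeqBox γ u → SeqBox γ v → (∀ j, u j ≤ v j) → B u ≤ B v)
    (hL : ∀ k, 0 ≤ L k) (hb : 0 < b) (hlo : ∀ u, SeqBox γ u → b ≤ B u) (hdom : ∀ u, SeqBox γ u → ∑ k ∈ range K, L k * u k ≤ B u)
    (hh : SeqBox γ h) (hf : MemFlow B gIR h) (hg : ∀ t, 0 < g t ∧ g t ≤ 1)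
    (hgF : ∀ t, 1 ≤ g t * (1 + ∑ k ∈ range K, L k * h (t + k) ^ 3 / 2))
    {k₂ k₃ k₄ k₅ : ℕ} (hk2 : 2 ≤ k₂) (hk3 : 59 * k₂ ≤ k₃)
    (h34l : 8 * k₃ < k₄) (h34h : k₄ ≤ 16 * k₃) (h45l : 3 * k₄ < k₅) (h45h : k₅ ≤ 4 * k₄) (hk5K : k₅ < K)
    (hLa : ∀ l, l < K → l ≠ 1 → l ≠ k₂ → l ≠ k₃ → l ≠ k₄ → l ≠ k₅ → L l = 0)
    {N : ℕ} {KL : ℕ → ℕ → ℕ → ℝ}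
    (hKL : ∀ k n l, KL k n l = if 0 < k ∧ k < K ∧ l < k then L k * h (n + k) ^ 3 / 2 * ∏ t ∈ Ico (n + 1 + l) (n + k + 1), g t else 0)
    {KA : ℕ → ℕ → ℕ → ℝ} {RA : ℕ → (ℕ → ℝ) → ℕ → ℝ}
    (hRA : ∀ i v m, RA i v m = ∑ l ∈ range K, KA i m l * v (m + 1 + l))
    (hKA : ∀ i m l, KA i m l = KL i m l + KA (i + 1) m l) (hKAtop : ∀ m l, KA K m l = 0)
    {e ε : ℕ → ℝ} (he0 : ∀ m, 0 ≤ e m) (hea : ∀ m, e (m + 1) ≤ e m)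
    (hεt : ∀ m, N < m → ε m = 0) (hεrec : ∀ m, ε m = e m - RA 1 ε m) : ∀ m, 0 ≤ ε m ∧ ε m ≤ e m := by
  have hk3r : (0 : ℝ) < k₃ := by exact_mod_cast (show 0 < k₃ by omega)
  have hk4r : (0 : ℝ) < k₄ := by exact_mod_cast (show 0 < k₄ by omega)
  have hρ : (59 : ℝ) * k₂ ≤ k₃ := by exact_mod_cast hk3
  have hG : (8 : ℝ) * k₃ ≤ k₄ := by exact_mod_cast h34l.le
  have hr3 : (56 : ℝ) ≤ k₃ := by exact_mod_cast (show 56 ≤ k₃ by omega)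
  have hX1c : ∀ q, ∑ k ∈ ({k₃} : Finset ℕ), (k : ℝ) * (L k * h (q + k) ^ 3 / 2) ≤ 3071 / 5000 := fun q => by
    rw [sum_singleton]; exact load_le_of_sq hmono hL hb hlo hdom hh hf (by omega) (by omega) (so := 3071 / 5000) (by norm_num) (by nlinarith) q
  have hX2c : ∀ q, ∑ k ∈ ({k₄, k₅} : Finset ℕ), (k : ℝ) * (L k * h (q + k) ^ 3 / 2) ≤ 129 / 200 := fun q =>
    (wide_pair_load_le4 hmono hL hb hlo hdom hh hf (by omega) (by omega) (by omega) hk5K q)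
  have hjoint : ∀ q, ∑ k ∈ ({k₃} : Finset ℕ), (k : ℝ) * (L k * h (q + k) ^ 3 / 2) + ∑ k ∈ ({k₄, k₅} : Finset ℕ), (k : ℝ) * (L k * h (q + k) ^ 3 / 2) ≤ 89 / 100 := fun q => by
    rw [sum_singleton, sum_pair (show k₄ ≠ k₅ by omega)]
    have := old_triple_load_le_cg4 hmono hL hb hlo hdom hh hf (by omega) h34l h34h h45l h45h hk5K q
    linarith
  rcases le_or_gt k₂ 29 with h29 | h30
  · exact flow_nonneg_young_pair_two_old_levels_of_cert hmono hL hb hlo hdom hh hf hg hgF hk2 h29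
      (S₁ := {k₃}) (S₂ := {k₄, k₅}) (lo₁ := k₃) (hi₁ := k₃) (lo₂ := k₄) (hi₂ := k₅)
      (fun k hk => by rw [mem_singleton] at hk; omega) (fun k hk => by simp only [mem_insert, mem_singleton] at hk; omega)
      (by omega) le_rfl (by omega) (by omega) hk5K (c₁ := 3071 / 5000) (c₂ := 129 / 200) (V := 89 / 100) (by norm_num) hX1c hX2c hjoint
      (fun X₁ X₂ κ₁ h1 h2 h3 h4 h5 h6 => cert_cg4 h1 h2 h3 h4 hk3r hk3r hG hρ h5 h6)
      (fun l hl h1 h2 h3 h4 => hLa l hl h1 h2 (fun he => h3 (by rw [he]; exact mem_singleton_self _))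
        (fun he => h4 (by rw [he]; exact mem_insert_self _ _)) (fun he => h4 (by rw [he]; exact mem_insert_of_mem (mem_singleton_self _))))
      hKL hRA hKA hKAtop he0 hea hεt hεrec
  · exact flow_nonneg_far_two_old_levels_of_cert hmono hL hb hlo hdom hh hf hg hgF (by omega)
      (S₁ := {k₃}) (S₂ := {k₄, k₅}) (lo₁ := k₃) (hi₁ := k₃) (lo₂ := k₄) (hi₂ := k₅)
      (fun k hk => by rw [mem_singleton] at hk; omega) (fun k hk => by simp only [mem_insert, mem_singleton] at hk; omega)
      (by omega) le_rfl (by omega) (by omega) hk5K (c₁ := 3071 / 5000) (c₂ := 129 / 200) (V := 89 / 100) (by norm_num) hX1c hX2c hjoint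
      (fun X₁ X₂ κ₁ h1 h2 h3 h4 h5 h6 => cert_cg4 h1 h2 h3 h4 hk3r hk3r hG hρ h5 h6)
      (fun l hl h1 h2 h3 h4 => hLa l hl h1 h2 (fun he => h3 (by rw [he]; exact mem_singleton_self _))
        (fun he => h4 (by rw [he]; exact mem_insert_self _ _)) (fun he => h4 (by rw [he]; exact mem_insert_of_mem (mem_singleton_self _))))
      hKL hRA hKA hKAtop he0 hea hεt hεrec
/-- **THE CENSUS FIVE AGES ON THE CELL `k₄∕k₃ ∈ (4,8]`, `k₅∕k₄ ∈ (8,16]` WITH TWO OLD LEVELS (option C): EVERY `k₂ ≥ 2`, `90·k₂ ≤ k₃`.**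
`0 ≤ ε ≤ e` at every pin, every horizon, every damping of the self-consistent class ((E105e) with the certificate `cert_c8g`; one block needed `ρ₀ =
388` (E104)). [folklore] -/
theorem flow_nonneg_census_five_ages_c8g_two
    (hmono : ∀ u v : ℕ → ℝ, SeqBox γ u → SeqBox γ v → (∀ j, u j ≤ v j) → B u ≤ B v)
    (hL : ∀ k, 0 ≤ L k) (hb : 0 < b) (hlo : ∀ u, SeqBox γ u → b ≤ B u) (hdom : ∀ u, SeqBox γ u → ∑ k ∈ range K, L k * u k ≤ B u)
    (hh : SeqBox γ h) (hf : MemFlow B gIR h) (hg : ∀ t, 0 < g t ∧ g t ≤ 1)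
    (hgF : ∀ t, 1 ≤ g t * (1 + ∑ k ∈ range K, L k * h (t + k) ^ 3 / 2))
    {k₂ k₃ k₄ k₅ : ℕ} (hk2 : 2 ≤ k₂) (hk3 : 90 * k₂ ≤ k₃)
    (h34l : 4 * k₃ < k₄) (h34h : k₄ ≤ 8 * k₃) (h45l : 8 * k₄ < k₅) (h45h : k₅ ≤ 16 * k₄) (hk5K : k₅ < K)
    (hLa : ∀ l, l < K → l ≠ 1 → l ≠ k₂ → l ≠ k₃ → l ≠ k₄ → l ≠ k₅ → L l = 0)
    {N : ℕ} {KL : ℕ → ℕ → ℕ → ℝ}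
    (hKL : ∀ k n l, KL k n l = if 0 < k ∧ k < K ∧ l < k then L k * h (n + k) ^ 3 / 2 * ∏ t ∈ Ico (n + 1 + l) (n + k + 1), g t else 0)
    {KA : ℕ → ℕ → ℕ → ℝ} {RA : ℕ → (ℕ → ℝ) → ℕ → ℝ}
    (hRA : ∀ i v m, RA i v m = ∑ l ∈ range K, KA i m l * v (m + 1 + l))
    (hKA : ∀ i m l, KA i m l = KL i m l + KA (i + 1) m l) (hKAtop : ∀ m l, KA K m l = 0)
    {e ε : ℕ → ℝ} (he0 : ∀ m, 0 ≤ e m) (hea : ∀ m, e (m + 1) ≤ e m)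
    (hεt : ∀ m, N < m → ε m = 0) (hεrec : ∀ m, ε m = e m - RA 1 ε m) : ∀ m, 0 ≤ ε m ∧ ε m ≤ e m := by
  have hk3r : (0 : ℝ) < k₃ := by exact_mod_cast (show 0 < k₃ by omega)
  have hk4r : (0 : ℝ) < k₄ := by exact_mod_cast (show 0 < k₄ by omega)
  have hρ : (90 : ℝ) * k₂ ≤ k₃ := by exact_mod_cast hk3
  have hG : (8 : ℝ) * k₄ ≤ k₅ := by exact_mod_cast h45l.le
  have hr5 : (56 : ℝ) ≤ k₅ := by exact_mod_cast (show 56 ≤ k₅ by omega)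
  have hX1c : ∀ q, ∑ k ∈ ({k₃, k₄} : Finset ℕ), (k : ℝ) * (L k * h (q + k) ^ 3 / 2) ≤ 17 / 25 := fun q =>
    (wide_pair_load_le8 hmono hL hb hlo hdom hh hf (by omega) (by omega) (by omega) (by omega) q)
  have hX2c : ∀ q, ∑ k ∈ ({k₅} : Finset ℕ), (k : ℝ) * (L k * h (q + k) ^ 3 / 2) ≤ 3071 / 5000 := fun q => by
    rw [sum_singleton]; exact load_le_of_sq hmono hL hb hlo hdom hh hf (by omega) hk5K (so := 3071 / 5000) (by norm_num) (by nlinarith) q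
  have hjoint : ∀ q, ∑ k ∈ ({k₃, k₄} : Finset ℕ), (k : ℝ) * (L k * h (q + k) ^ 3 / 2) + ∑ k ∈ ({k₅} : Finset ℕ), (k : ℝ) * (L k * h (q + k) ^ 3 / 2) ≤ 19 / 20 := fun q => by
    rw [sum_singleton, sum_pair (show k₃ ≠ k₄ by omega)]
    exact old_triple_load_le_c8g hmono hL hb hlo hdom hh hf (by omega) h34l h34h h45l h45h hk5K q
  rcases le_or_gt k₂ 29 with h29 | h30
  · exact flow_nonneg_young_pair_two_old_levels_of_cert hmono hL hb hlo hdom hh hf hg hgF hk2 h29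
      (S₁ := {k₃, k₄}) (S₂ := {k₅}) (lo₁ := k₃) (hi₁ := k₄) (lo₂ := k₅) (hi₂ := k₅)
      (fun k hk => by simp only [mem_insert, mem_singleton] at hk; omega) (fun k hk => by rw [mem_singleton] at hk; omega)
      (by omega) (by omega) (by omega) le_rfl hk5K (c₁ := 17 / 25) (c₂ := 3071 / 5000) (V := 19 / 20) (by norm_num) hX1c hX2c hjoint
      (fun X₁ X₂ κ₁ h1 h2 h3 h4 h5 h6 => cert_c8g h1 h2 h3 h4 hk3r hk4r hG hρ h5 h6)
      (fun l hl h1 h2 h3 h4 => hLa l hl h1 h2 (fun he => h3 (by rw [he]; exact mem_insert_self _ _))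
        (fun he => h3 (by rw [he]; exact mem_insert_of_mem (mem_singleton_self _))) (fun he => h4 (by rw [he]; exact mem_singleton_self _)))
      hKL hRA hKA hKAtop he0 hea hεt hεrec
  · exact flow_nonneg_far_two_old_levels_of_cert hmono hL hb hlo hdom hh hf hg hgF (by omega)
      (S₁ := {k₃, k₄}) (S₂ := {k₅}) (lo₁ := k₃) (hi₁ := k₄) (lo₂ := k₅) (hi₂ := k₅)
      (fun k hk => by simp only [mem_insert, mem_singleton] at hk; omega) (fun k hk => by rw [mem_singleton] at hk; omega)
      (by omega) (by omega) (by omega) le_rfl hk5K (c₁ := 17 / 25) (c₂ := 3071 / 5000) (V := 19 / 20) (by norm_num) hX1c hX2c hjoint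
      (fun X₁ X₂ κ₁ h1 h2 h3 h4 h5 h6 => cert_c8g h1 h2 h3 h4 hk3r hk4r hG hρ h5 h6)
      (fun l hl h1 h2 h3 h4 => hLa l hl h1 h2 (fun he => h3 (by rw [he]; exact mem_insert_self _ _))
        (fun he => h3 (by rw [he]; exact mem_insert_of_mem (mem_singleton_self _))) (fun he => h4 (by rw [he]; exact mem_singleton_self _)))
      hKL hRA hKA hKAtop he0 hea hεt hεrec
/-- **THE CENSUS FIVE AGES ON THE CELL `k₄∕k₃ ∈ (8,16]`, `k₅∕k₄ ∈ (4,8]` WITH TWO OLD LEVELS (option B): EVERY `k₂ ≥ 2`, `78·k₂ ≤ k₃`.**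
`0 ≤ ε ≤ e` at every pin, every horizon, every damping of the self-consistent class ((E105e) with the certificate `cert_cg8`; one block needed `ρ₀ =
493` (E104)). [folklore] -/
theorem flow_nonneg_census_five_ages_cg8_two
    (hmono : ∀ u v : ℕ → ℝ, SeqBox γ u → SeqBox γ v → (∀ j, u j ≤ v j) → B u ≤ B v)
    (hL : ∀ k, 0 ≤ L k) (hb : 0 < b) (hlo : ∀ u, SeqBox γ u → b ≤ B u) (hdom : ∀ u, SeqBox γ u → ∑ k ∈ range K, L k * u k ≤ B u)
    (hh : SeqBox γ h) (hf : MemFlow B gIR h) (hg : ∀ t, 0 < g t ∧ g t ≤ 1)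
    (hgF : ∀ t, 1 ≤ g t * (1 + ∑ k ∈ range K, L k * h (t + k) ^ 3 / 2))
    {k₂ k₃ k₄ k₅ : ℕ} (hk2 : 2 ≤ k₂) (hk3 : 78 * k₂ ≤ k₃)
    (h34l : 8 * k₃ < k₄) (h34h : k₄ ≤ 16 * k₃) (h45l : 4 * k₄ < k₅) (h45h : k₅ ≤ 8 * k₄) (hk5K : k₅ < K)
    (hLa : ∀ l, l < K → l ≠ 1 → l ≠ k₂ → l ≠ k₃ → l ≠ k₄ → l ≠ k₅ → L l = 0)
    {N : ℕ} {KL : ℕ → ℕ → ℕ → ℝ}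
    (hKL : ∀ k n l, KL k n l = if 0 < k ∧ k < K ∧ l < k then L k * h (n + k) ^ 3 / 2 * ∏ t ∈ Ico (n + 1 + l) (n + k + 1), g t else 0)
    {KA : ℕ → ℕ → ℕ → ℝ} {RA : ℕ → (ℕ → ℝ) → ℕ → ℝ}
    (hRA : ∀ i v m, RA i v m = ∑ l ∈ range K, KA i m l * v (m + 1 + l))
    (hKA : ∀ i m l, KA i m l = KL i m l + KA (i + 1) m l) (hKAtop : ∀ m l, KA K m l = 0)
    {e ε : ℕ → ℝ} (he0 : ∀ m, 0 ≤ e m) (hea : ∀ m, e (m + 1) ≤ e m)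
    (hεt : ∀ m, N < m → ε m = 0) (hεrec : ∀ m, ε m = e m - RA 1 ε m) : ∀ m, 0 ≤ ε m ∧ ε m ≤ e m := by
  have hk3r : (0 : ℝ) < k₃ := by exact_mod_cast (show 0 < k₃ by omega)
  have hk4r : (0 : ℝ) < k₄ := by exact_mod_cast (show 0 < k₄ by omega)
  have hρ : (78 : ℝ) * k₂ ≤ k₃ := by exact_mod_cast hk3
  have hG : (8 : ℝ) * k₃ ≤ k₄ := by exact_mod_cast h34l.le
  have hr3 : (56 : ℝ) ≤ k₃ := by exact_mod_cast (show 56 ≤ k₃ by omega)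
  have hX1c : ∀ q, ∑ k ∈ ({k₃} : Finset ℕ), (k : ℝ) * (L k * h (q + k) ^ 3 / 2) ≤ 3071 / 5000 := fun q => by
    rw [sum_singleton]; exact load_le_of_sq hmono hL hb hlo hdom hh hf (by omega) (by omega) (so := 3071 / 5000) (by norm_num) (by nlinarith) q
  have hX2c : ∀ q, ∑ k ∈ ({k₄, k₅} : Finset ℕ), (k : ℝ) * (L k * h (q + k) ^ 3 / 2) ≤ 17 / 25 := fun q =>
    (wide_pair_load_le8 hmono hL hb hlo hdom hh hf (by omega) (by omega) (by omega) hk5K q)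
  have hjoint : ∀ q, ∑ k ∈ ({k₃} : Finset ℕ), (k : ℝ) * (L k * h (q + k) ^ 3 / 2) + ∑ k ∈ ({k₄, k₅} : Finset ℕ), (k : ℝ) * (L k * h (q + k) ^ 3 / 2) ≤ 24 / 25 := fun q => by
    rw [sum_singleton, sum_pair (show k₄ ≠ k₅ by omega)]
    have := old_triple_load_le_cg8 hmono hL hb hlo hdom hh hf (by omega) h34l h34h h45l h45h hk5K q
    linarith
  rcases le_or_gt k₂ 29 with h29 | h30
  · exact flow_nonneg_young_pair_two_old_levels_of_cert hmono hL hb hlo hdom hh hf hg hgF hk2 h29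
      (S₁ := {k₃}) (S₂ := {k₄, k₅}) (lo₁ := k₃) (hi₁ := k₃) (lo₂ := k₄) (hi₂ := k₅)
      (fun k hk => by rw [mem_singleton] at hk; omega) (fun k hk => by simp only [mem_insert, mem_singleton] at hk; omega)
      (by omega) le_rfl (by omega) (by omega) hk5K (c₁ := 3071 / 5000) (c₂ := 17 / 25) (V := 24 / 25) (by norm_num) hX1c hX2c hjoint
      (fun X₁ X₂ κ₁ h1 h2 h3 h4 h5 h6 => cert_cg8 h1 h2 h3 h4 hk3r hk3r hG hρ h5 h6)
      (fun l hl h1 h2 h3 h4 => hLa l hl h1 h2 (fun he => h3 (by rw [he]; exact mem_singleton_self _))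
        (fun he => h4 (by rw [he]; exact mem_insert_self _ _)) (fun he => h4 (by rw [he]; exact mem_insert_of_mem (mem_singleton_self _))))
      hKL hRA hKA hKAtop he0 hea hεt hεrec
  · exact flow_nonneg_far_two_old_levels_of_cert hmono hL hb hlo hdom hh hf hg hgF (by omega)
      (S₁ := {k₃}) (S₂ := {k₄, k₅}) (lo₁ := k₃) (hi₁ := k₃) (lo₂ := k₄) (hi₂ := k₅)
      (fun k hk => by rw [mem_singleton] at hk; omega) (fun k hk => by simp only [mem_insert, mem_singleton] at hk; omega)
      (by omega) le_rfl (by omega) (by omega) hk5K (c₁ := 3071 / 5000) (c₂ := 17 / 25) (V := 24 / 25) (by norm_num) hX1c hX2c hjoint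
      (fun X₁ X₂ κ₁ h1 h2 h3 h4 h5 h6 => cert_cg8 h1 h2 h3 h4 hk3r hk3r hG hρ h5 h6)
      (fun l hl h1 h2 h3 h4 => hLa l hl h1 h2 (fun he => h3 (by rw [he]; exact mem_singleton_self _))
        (fun he => h4 (by rw [he]; exact mem_insert_self _ _)) (fun he => h4 (by rw [he]; exact mem_insert_of_mem (mem_singleton_self _))))
      hKL hRA hKA hKAtop he0 hea hεt hεrec
/-! ## §2 The unions for every `k₂` -/

/-- **THE CENSUS FIVE AGES FOR EVERY `k₂ ≥ 2`, BOTH TOP RATIOS AT MOST 8, SEPARATION 184.**  `2 ≤ k₂`, `184k₂ ≤ k₃`, `k₃ < k₄ ≤ 8k₃`, `k₄ < k₅ ≤ 8k₄`,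
`k₅ < K`: `0 ≤ ε ≤ e` at every pin ((E104e) `…_top4_every` on `(1,4]²`, the two-level cells elsewhere; (E104e)'s `…_top8_every` asked `233k₂`). [folklore] -/
theorem flow_nonneg_census_five_ages_top8_two
    (hmono : ∀ u v : ℕ → ℝ, SeqBox γ u → SeqBox γ v → (∀ j, u j ≤ v j) → B u ≤ B v)
    (hL : ∀ k, 0 ≤ L k) (hb : 0 < b) (hlo : ∀ u, SeqBox γ u → b ≤ B u) (hdom : ∀ u, SeqBox γ u → ∑ k ∈ range K, L k * u k ≤ B u)
    (hh : SeqBox γ h) (hf : MemFlow B gIR h) (hg : ∀ t, 0 < g t ∧ g t ≤ 1)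
    (hgF : ∀ t, 1 ≤ g t * (1 + ∑ k ∈ range K, L k * h (t + k) ^ 3 / 2))
    {k₂ k₃ k₄ k₅ : ℕ} (hk2 : 2 ≤ k₂) (hk3 : 184 * k₂ ≤ k₃)
    (h34l : k₃ < k₄) (h34h : k₄ ≤ 8 * k₃) (h45l : k₄ < k₅) (h45h : k₅ ≤ 8 * k₄) (hk5K : k₅ < K)
    (hLa : ∀ l, l < K → l ≠ 1 → l ≠ k₂ → l ≠ k₃ → l ≠ k₄ → l ≠ k₅ → L l = 0)
    {N : ℕ} {KL : ℕ → ℕ → ℕ → ℝ}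
    (hKL : ∀ k n l, KL k n l = if 0 < k ∧ k < K ∧ l < k then L k * h (n + k) ^ 3 / 2 * ∏ t ∈ Ico (n + 1 + l) (n + k + 1), g t else 0)
    {KA : ℕ → ℕ → ℕ → ℝ} {RA : ℕ → (ℕ → ℝ) → ℕ → ℝ}
    (hRA : ∀ i v m, RA i v m = ∑ l ∈ range K, KA i m l * v (m + 1 + l))
    (hKA : ∀ i m l, KA i m l = KL i m l + KA (i + 1) m l) (hKAtop : ∀ m l, KA K m l = 0)
    {e ε : ℕ → ℝ} (he0 : ∀ m, 0 ≤ e m) (hea : ∀ m, e (m + 1) ≤ e m)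
    (hεt : ∀ m, N < m → ε m = 0) (hεrec : ∀ m, ε m = e m - RA 1 ε m) : ∀ m, 0 ≤ ε m ∧ ε m ≤ e m := by
  rcases le_or_gt k₄ (4 * k₃) with ha | ha
  · rcases le_or_gt k₅ (4 * k₄) with hb' | hb'
    · exact flow_nonneg_census_five_ages_top4_every hmono hL hb hlo hdom hh hf hg hgF hk2 (by omega) h34l ha h45l hb' hk5K hLa hKL hRA hKA hKAtop he0 hea hεt hεrec
    rcases le_or_gt k₄ (2 * k₃) with h2 | h2
    · exact flow_nonneg_census_five_ages_c28_two hmono hL hb hlo hdom hh hf hg hgF hk2 (by omega) (by omega) h2 hb' h45h hk5K hLa hKL hRA hKA hKAtop he0 hea hεt hεrec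
    rcases le_or_gt k₄ (3 * k₃) with h3 | h3
    · exact flow_nonneg_census_five_ages_c38_two hmono hL hb hlo hdom hh hf hg hgF hk2 (by omega) h2 h3 hb' h45h hk5K hLa hKL hRA hKA hKAtop he0 hea hεt hεrec
    · exact flow_nonneg_census_five_ages_c48_two hmono hL hb hlo hdom hh hf hg hgF hk2 (by omega) h3 ha hb' h45h hk5K hLa hKL hRA hKA hKAtop he0 hea hεt hεrec
  rcases le_or_gt k₅ (2 * k₄) with h2 | h2
  · exact flow_nonneg_census_five_ages_c82_two hmono hL hb hlo hdom hh hf hg hgF hk2 (by omega) ha h34h (by omega) h2 hk5K hLa hKL hRA hKA hKAtop he0 hea hεt hεrec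
  rcases le_or_gt k₅ (3 * k₄) with h3 | h3
  · exact flow_nonneg_census_five_ages_c83_two hmono hL hb hlo hdom hh hf hg hgF hk2 (by omega) ha h34h h2 h3 hk5K hLa hKL hRA hKA hKAtop he0 hea hεt hεrec
  rcases le_or_gt k₅ (4 * k₄) with h4 | h4
  · exact flow_nonneg_census_five_ages_c84_two hmono hL hb hlo hdom hh hf hg hgF hk2 (by omega) ha h34h h3 h4 hk5K hLa hKL hRA hKA hKAtop he0 hea hεt hεrec
  · exact flow_nonneg_census_five_ages_c88_two hmono hL hb hlo hdom hh hf hg hgF hk2 (by omega) ha h34h h4 h45h hk5K hLa hKL hRA hKA hKAtop he0 hea hεt hεrec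

/-- **THE CENSUS FIVE AGES FOR EVERY `k₂ ≥ 2`, `k₄ ≤ 8k₃`, `k₅ ≤ 16k₄`, SEPARATION 184** ((E104f) asked `388k₂`). [folklore] -/
theorem flow_nonneg_census_five_ages_top8x16_two
    (hmono : ∀ u v : ℕ → ℝ, SeqBox γ u → SeqBox γ v → (∀ j, u j ≤ v j) → B u ≤ B v)
    (hL : ∀ k, 0 ≤ L k) (hb : 0 < b) (hlo : ∀ u, SeqBox γ u → b ≤ B u) (hdom : ∀ u, SeqBox γ u → ∑ k ∈ range K, L k * u k ≤ B u)
    (hh : SeqBox γ h) (hf : MemFlow B gIR h) (hg : ∀ t, 0 < g t ∧ g t ≤ 1)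
    (hgF : ∀ t, 1 ≤ g t * (1 + ∑ k ∈ range K, L k * h (t + k) ^ 3 / 2))
    {k₂ k₃ k₄ k₅ : ℕ} (hk2 : 2 ≤ k₂) (hk3 : 184 * k₂ ≤ k₃)
    (h34l : k₃ < k₄) (h34h : k₄ ≤ 8 * k₃) (h45l : k₄ < k₅) (h45h : k₅ ≤ 16 * k₄) (hk5K : k₅ < K)
    (hLa : ∀ l, l < K → l ≠ 1 → l ≠ k₂ → l ≠ k₃ → l ≠ k₄ → l ≠ k₅ → L l = 0)
    {N : ℕ} {KL : ℕ → ℕ → ℕ → ℝ}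
    (hKL : ∀ k n l, KL k n l = if 0 < k ∧ k < K ∧ l < k then L k * h (n + k) ^ 3 / 2 * ∏ t ∈ Ico (n + 1 + l) (n + k + 1), g t else 0)
    {KA : ℕ → ℕ → ℕ → ℝ} {RA : ℕ → (ℕ → ℝ) → ℕ → ℝ}
    (hRA : ∀ i v m, RA i v m = ∑ l ∈ range K, KA i m l * v (m + 1 + l))
    (hKA : ∀ i m l, KA i m l = KL i m l + KA (i + 1) m l) (hKAtop : ∀ m l, KA K m l = 0)
    {e ε : ℕ → ℝ} (he0 : ∀ m, 0 ≤ e m) (hea : ∀ m, e (m + 1) ≤ e m)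
    (hεt : ∀ m, N < m → ε m = 0) (hεrec : ∀ m, ε m = e m - RA 1 ε m) : ∀ m, 0 ≤ ε m ∧ ε m ≤ e m := by
  rcases le_or_gt k₅ (8 * k₄) with hb' | hb'
  · exact flow_nonneg_census_five_ages_top8_two hmono hL hb hlo hdom hh hf hg hgF hk2 hk3 h34l h34h h45l hb' hk5K hLa hKL hRA hKA hKAtop he0 hea hεt hεrec
  rcases le_or_gt k₄ (2 * k₃) with h2 | h2
  · exact flow_nonneg_census_five_ages_c2g_two hmono hL hb hlo hdom hh hf hg hgF hk2 (by omega) (by omega) h2 hb' h45h hk5K hLa hKL hRA hKA hKAtop he0 hea hεt hεrec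
  rcases le_or_gt k₄ (3 * k₃) with h3 | h3
  · exact flow_nonneg_census_five_ages_c3g_two hmono hL hb hlo hdom hh hf hg hgF hk2 (by omega) h2 h3 hb' h45h hk5K hLa hKL hRA hKA hKAtop he0 hea hεt hεrec
  rcases le_or_gt k₄ (4 * k₃) with h4 | h4
  · exact flow_nonneg_census_five_ages_c4g_two hmono hL hb hlo hdom hh hf hg hgF hk2 (by omega) h3 h4 hb' h45h hk5K hLa hKL hRA hKA hKAtop he0 hea hεt hεrec
  · exact flow_nonneg_census_five_ages_c8g_two hmono hL hb hlo hdom hh hf hg hgF hk2 (by omega) h4 h34h hb' h45h hk5K hLa hKL hRA hKA hKAtop he0 hea hεt hεrec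

/-- **THE CENSUS FIVE AGES FOR EVERY `k₂ ≥ 2`, `k₄ ≤ 16k₃`, `k₅ ≤ 8k₄`, SEPARATION 184** ((E104f) asked `493k₂`). [folklore] -/
theorem flow_nonneg_census_five_ages_top16x8_two
    (hmono : ∀ u v : ℕ → ℝ, SeqBox γ u → SeqBox γ v → (∀ j, u j ≤ v j) → B u ≤ B v)
    (hL : ∀ k, 0 ≤ L k) (hb : 0 < b) (hlo : ∀ u, SeqBox γ u → b ≤ B u) (hdom : ∀ u, SeqBox γ u → ∑ k ∈ range K, L k * u k ≤ B u)
    (hh : SeqBox γ h) (hf : MemFlow B gIR h) (hg : ∀ t, 0 < g t ∧ g t ≤ 1)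
    (hgF : ∀ t, 1 ≤ g t * (1 + ∑ k ∈ range K, L k * h (t + k) ^ 3 / 2))
    {k₂ k₃ k₄ k₅ : ℕ} (hk2 : 2 ≤ k₂) (hk3 : 184 * k₂ ≤ k₃)
    (h34l : k₃ < k₄) (h34h : k₄ ≤ 16 * k₃) (h45l : k₄ < k₅) (h45h : k₅ ≤ 8 * k₄) (hk5K : k₅ < K)
    (hLa : ∀ l, l < K → l ≠ 1 → l ≠ k₂ → l ≠ k₃ → l ≠ k₄ → l ≠ k₅ → L l = 0)
    {N : ℕ} {KL : ℕ → ℕ → ℕ → ℝ}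
    (hKL : ∀ k n l, KL k n l = if 0 < k ∧ k < K ∧ l < k then L k * h (n + k) ^ 3 / 2 * ∏ t ∈ Ico (n + 1 + l) (n + k + 1), g t else 0)
    {KA : ℕ → ℕ → ℕ → ℝ} {RA : ℕ → (ℕ → ℝ) → ℕ → ℝ}
    (hRA : ∀ i v m, RA i v m = ∑ l ∈ range K, KA i m l * v (m + 1 + l))
    (hKA : ∀ i m l, KA i m l = KL i m l + KA (i + 1) m l) (hKAtop : ∀ m l, KA K m l = 0)
    {e ε : ℕ → ℝ} (he0 : ∀ m, 0 ≤ e m) (hea : ∀ m, e (m + 1) ≤ e m)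
    (hεt : ∀ m, N < m → ε m = 0) (hεrec : ∀ m, ε m = e m - RA 1 ε m) : ∀ m, 0 ≤ ε m ∧ ε m ≤ e m := by
  rcases le_or_gt k₄ (8 * k₃) with ha | ha
  · exact flow_nonneg_census_five_ages_top8_two hmono hL hb hlo hdom hh hf hg hgF hk2 hk3 h34l ha h45l h45h hk5K hLa hKL hRA hKA hKAtop he0 hea hεt hεrec
  rcases le_or_gt k₅ (2 * k₄) with h2 | h2
  · exact flow_nonneg_census_five_ages_cg2_two hmono hL hb hlo hdom hh hf hg hgF hk2 (by omega) ha h34h (by omega) h2 hk5K hLa hKL hRA hKA hKAtop he0 hea hεt hεrec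
  rcases le_or_gt k₅ (3 * k₄) with h3 | h3
  · exact flow_nonneg_census_five_ages_cg3_two hmono hL hb hlo hdom hh hf hg hgF hk2 (by omega) ha h34h h2 h3 hk5K hLa hKL hRA hKA hKAtop he0 hea hεt hεrec
  rcases le_or_gt k₅ (4 * k₄) with h4 | h4
  · exact flow_nonneg_census_five_ages_cg4_two hmono hL hb hlo hdom hh hf hg hgF hk2 (by omega) ha h34h h3 h4 hk5K hLa hKL hRA hKA hKAtop he0 hea hεt hεrec
  · exact flow_nonneg_census_five_ages_cg8_two hmono hL hb hlo hdom hh hf hg hgF hk2 (by omega) ha h34h h4 h45h hk5K hLa hKL hRA hKA hKAtop he0 hea hεt hεrec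

end Summit.QuantumFields.BalabanUV.Beta.EriceRemainderEnclosureHistoryAutonomyComparisonAgeCompositionFiveAgesTwoLevelsD
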